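import Mathlib
import Literature.NumberTheory.EllipticCurves.IwasawaAlgebra

/-!
# STUB-IDEAS k3 g33 — «THE TOWER AT `v` IS WITT»: the instantiation duties R202 ⊕ R201′ ⊕ (S-Y)
# split into sub-stubs over CONCRETE Mathlib carriers, glue PROVED

Stub-ideation sketch (k = 3, gen 33; HOME family 3 «probe the extremes»; director technique =
decomposition with a provable glue) for `stub_heegnerIndexLowerAtTwo` of the crux
`SplitBadTwoLowerHalfOfFacts` (route `PrintCf2`, item `stmt-BirchSwinnertonDyer-27851`);
card `Ideas/stub_heegnerIndexLowerAtTwo-k3.md` (gate slug `stub-heegnerindexloweratwo-k3-g33`).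

**HONESTY.** BSD is NOT proved by any of this; the crux is NOT proved; the stub is NOT proved; no net
digit `D_c(key)` is asserted (B45 / E1).  Nothing below mentions an elliptic curve.  What IS here:

* §0 **THE CARRIERS OF RECORD AT `v` (proposal) and their Mathlib certificates.**  The unramified
  `ℤ₂`-tower `F_∞/ℚ₂` has `𝒪_{F_n} = W(𝔽_{2^{2^n}})` (Serre, *Local Fields* II §5 Thm 4 with `e = 1`), so
  `𝒪_{F_n} := WittVector 2 (GaloisField 2 (2^n))`, `φ := WittVector.frobenius`; Mathlib CERTIFIES (by
  `inferInstance` / named decls, checked below): `𝕎(k_n)` is a DVR (`WittVector.isDiscreteValuationRing`),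
  `2`-adically complete (`WittVector.isAdicCompleteIdealSpanP`), residue ring `k_n`
  (`WittVector.quotientPEquiv`), `𝕎(𝔽₂) ≃+* ℤ₂` (`WittVector.equiv`), `k_n/𝔽₂` Galois with a NORMAL BASIS
  (`IsGalois.normalBasis` — Mathlib, not print), residue traces / norms onto (`Algebra.trace_surjective`,
  `FiniteField.norm_surjective`); the deciding layer-`1` frame field `L_1 = ℚ₂(ζ₁₂)` (ONE field for BOTH
  conductor-`4` keys `u = −1, 3`) is `CyclotomicField 12 ℚ_[2]`, normed by `spectralNorm.nontriviallyNormedField`.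
* §1 **INTEGRAL NORMAL BASIS LEMMA (glue, PROVED, any rings):** over a commutative `R` with an ideal
  `I ≤ Jac(R)` and an `R`-algebra `A` (think `A = ℤ₂[G_n]`), an `A`-module `M` finite over `R` that is
  abstractly `R`-isomorphic to `A` and has a RESIDUAL generator `θ` (`M = A·θ + I·M`) is FREE OF RANK ONE
  over `A` on `θ` — Nakayama (`Submodule.le_of_le_smul_of_le_jacobson_bot`) for onto, Orzech / Vasconcelos
  (`OrzechProperty.injective_of_surjective_of_injective`) for into.  Instance: `M = 𝕎(k_n)`, `I = (2)`,
  residual generator = a lift of the normal-basis generator of `k_n/𝔽₂` ⟹ `𝒪_{F_n} ≅ ℤ₂[G_n]`.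
* §2 **GENERATOR LIFTING STEP (glue, PROVED):** along a surjection `ρ : R' ↠ R` from a LOCAL ring and a
  `ρ`-semilinear surjection `t : M' ↠ M` (the trace `𝒪_{F_{n+1}} ↠ 𝒪_{F_n}`, onto because unramified),
  every free generator of `M` is the image of a free generator of `M'` — unit lifting
  (`IsLocalHom.of_surjective`, `isUnit_map_iff`).
* §3 **TRACE-COMPATIBLE GENERATORS (glue, PROVED) = (S-Y) in Loeffler–Zerbes' own form** (arXiv:1108.5954
  Prop. 3.3, so far consumed as PRINT, locator E2): dependent choice on §2 gives `θ = (θ_n)_n` with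
  `Tr θ_{n+1} = θ_n`, each level free of rank one on `θ_n`; the level isomorphisms `r ↦ r·θ_n` are
  compatible (`levelEquiv_compat`), and composed with `Λ_v ↠ ℤ₂[G_n]` (kernel `ω_n`, sub-stub W-Λ) they
  give EXACTLY the `(ev, hev, hker)` that k3-g32's `conductorFour_package` / `conductorEight_package`
  consume (`consumer_ev`: surjective, `ker ev = ker(Λ ↠ ℤ₂[G_n])`).
* §4 **TYPED WITT-LEVEL SUB-STUBS (signatures, not proved):** W-FIN `𝕎(k_n)` finite free of rank `2^n`
  over `𝕎(𝔽₂)`; W-INB the integral normal basis at level `n` in Witt coordinates; W-Λ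
  `Λ₂/ω_n ≃ₐ ℤ₂[C_{2^n}]`.
* §5 **THE EXTREME LAYER (family 3): the ONE finite frame that decides conductor 4.**  `L_1 = ℚ₂(ζ₁₂)`
  `:= CyclotomicField 12 ℚ_[2]` as a complete normed `ℚ₂`-algebra (certificate); PROVED: `i = ζ₁₂³`,
  `ζ₃ = ζ₁₂⁴ ∈ L_1`; the METRIC certificate `‖1 + i‖² = ‖2‖ = 1/2` for the spectral norm (so
  `|ϖ| = 2^{-1/2} ∉ |ℚ₂ˣ|`, `e ≥ 2`) from multiplicativity of `spectralMulAlgNorm` alone; and, modulo the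
  typed friction F-DEG (`Φ₁₂` irreducible over `ℚ₂` — Serre LF IV §4 Props 16–17), the ALGEBRAIC frame
  `σ = (ζ ↦ ζ⁷)`, `φ = (ζ ↦ ζ⁵)`: `σ² = 1`, `σφ = φσ`, `σ i = −i`, `φ i = i`, `σ|ζ₃ = id`, `φ ζ₃ = ζ₃²`
  (`frameFourLayerOneAlgebraic_of_irreducible`) — R205 (i) algebraic half + (vi) at layer 1.
-/

noncomputable section

set_option linter.dupNamespace false
set_option autoImplicit false

open Function

namespace Summit.BirchSwinnertonDyer.BirchSwinnertonDyer.Cruxes.SplitBadTwoLowerHalfOfFacts.WittTowerK3G33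

/-! ## §0 The carriers at `v` and their Mathlib certificates -/

/-- The residue tower `k_n = 𝔽_{2^{2^n}}` of the unramified `ℤ₂`-extension `F_∞/ℚ₂`. -/
abbrev kF (n : ℕ) : Type := GaloisField 2 (2 ^ n)

/-- **Carrier of record (proposal):** `𝒪_{F_n} := W(𝔽_{2^{2^n}})` (Serre LF II §5 Thm 4, `e = 1`). -/
abbrev OF (n : ℕ) : Type := WittVector 2 (kF n)

/-- The arithmetic Frobenius `φ` of `F_n/ℚ₂` on `𝒪_{F_n}` is the Witt-vector Frobenius. -/
def frob (n : ℕ) : OF n →+* OF n := WittVector.frobenius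

/-- `G_n = Gal(F_n/ℚ₂) = Gal(k_n/𝔽₂)` acts on `𝒪_{F_n}` through the Witt functor. -/
def galAct (n : ℕ) (g : kF n ≃ₐ[ZMod 2] kF n) : OF n →+* OF n :=
  WittVector.map (g : kF n →+* kF n)

/-- `𝕎(𝔽₂) = ℤ₂` acts on `𝕎(k_n)` (the `ℤ₂`-module structure of `𝒪_{F_n}`). -/
instance wittAlgebra (n : ℕ) : Algebra (WittVector 2 (ZMod 2)) (OF n) :=
  (WittVector.map (algebraMap (ZMod 2) (kF n))).toAlgebra

/-- Certificate: `𝒪_{F_n}` is a discrete valuation ring (Mathlib). -/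
example (n : ℕ) : IsDiscreteValuationRing (OF n) := inferInstance

/-- Certificate: `𝒪_{F_n}` is `2`-adically complete (Mathlib). -/
example (n : ℕ) : IsAdicComplete (Ideal.span {((2 : ℕ) : OF n)}) (OF n) := inferInstance

/-- Certificate: the residue ring of `𝒪_{F_n}` is `k_n` (Mathlib). -/
example (n : ℕ) : OF n ⧸ Ideal.span {((2 : ℕ) : OF n)} ≃+* kF n := WittVector.quotientPEquiv

/-- Certificate: `W(𝔽₂) = ℤ₂` (Mathlib). -/
example : WittVector 2 (ZMod 2) ≃+* ℤ_[2] := WittVector.equiv 2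

/-- Certificate: `k_n/𝔽₂` is Galois (Mathlib instance for finite fields). -/
example (n : ℕ) : IsGalois (ZMod 2) (kF n) := inferInstance

/-- Certificate: the NORMAL BASIS of `k_n/𝔽₂` is a Mathlib theorem, not a print input. -/
example (n : ℕ) : Module.Basis (kF n ≃ₐ[ZMod 2] kF n) (ZMod 2) (kF n) :=
  IsGalois.normalBasis (ZMod 2) (kF n)

/-- **The proved neighbouring case (family 3): the RESIDUAL normal basis in exactly the shape of the
Witt-level sub-stub W-INB (§4)** — some `θ̄ ∈ k_n` whose Galois conjugates are an `𝔽₂`-basis, i.e.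
`c ↦ Σ_g c_g · g θ̄` is a bijection `𝔽₂^{G_n} → k_n`.  PROVED (Mathlib `IsGalois.normalBasis`); W-INB is
its lift through `𝕎(k_n) ↠ k_n` by §1. -/
theorem residual_normal_basis (n : ℕ) : ∃ θ : kF n, Function.Bijective
    (fun c : (kF n ≃ₐ[ZMod 2] kF n) → ZMod 2 => ∑ g, c g • g θ) := by
  classical
  let b := IsGalois.normalBasis (ZMod 2) (kF n)
  refine ⟨b 1, ?_⟩
  have h : (fun c : (kF n ≃ₐ[ZMod 2] kF n) → ZMod 2 => ∑ g, c g • g (b 1)) =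
      fun c => b.equivFun.symm c := by
    funext c
    rw [Module.Basis.equivFun_symm_apply]
    refine Finset.sum_congr rfl fun g _ => ?_
    rw [← IsGalois.normalBasis_apply]
  rw [h]
  exact b.equivFun.symm.bijective

/-- Certificate: `[k_n : 𝔽₂] = 2^n`. -/
example (n : ℕ) : Module.finrank (ZMod 2) (kF n) = 2 ^ n :=
  GaloisField.finrank 2 (pow_ne_zero n two_ne_zero)

/-- Certificate (residue input of Serre V §2 Prop. 3 (a), the norm-onto sub-stub W-NORM): traces
between finite fields are onto. -/
example (K K' : Type) [Field K] [Field K'] [Finite K'] [Algebra K K'] :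
    Function.Surjective (Algebra.trace K K') := by
  haveI : Finite K := Finite.of_injective _ (algebraMap K K').injective
  exact Algebra.trace_surjective K K'

/-- The Galois action on `𝒪_{F_n}` reduces to the Galois action on `k_n` (coefficientwise). -/
theorem constantCoeff_galAct (n : ℕ) (g : kF n ≃ₐ[ZMod 2] kF n) (x : OF n) :
    WittVector.constantCoeff (galAct n g x) = g (WittVector.constantCoeff x) := by
  simp [galAct, WittVector.constantCoeff, WittVector.map_coeff]

/-! ## §1 The integral normal basis lemma (Nakayama + Orzech), any rings -/

section INB

variable {R : Type*} [CommRing R] {A : Type*} [Ring A] [Algebra R A]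
variable {M : Type*} [AddCommGroup M] [Module A M] [Module R M] [IsScalarTower R A M]

/-- `θ` is a FREE GENERATOR of the `A`-module `M`: `a ↦ a·θ` is a bijection `A → M`. -/
def IsGen (A : Type*) [Semiring A] {M : Type*} [AddCommMonoid M] [Module A M] (θ : M) : Prop :=
  Function.Bijective (LinearMap.toSpanSingleton A M θ)

/-- **Nakayama half.** If `M` is finite over `R`, `I ≤ Jac R`, and `θ` generates `M` RESIDUALLY
(`M ≤ A·θ + I·M`), then `θ` generates `M` over `A`. [Mathlib `Submodule.le_of_le_smul_of_le_jacobson_bot`] -/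
theorem surjective_toSpanSingleton_of_residual [Module.Finite R M] (I : Ideal R)
    (hI : I ≤ (⊥ : Ideal R).jacobson) (θ : M)
    (hspan : (⊤ : Submodule R M) ≤ (Submodule.span A {θ}).restrictScalars R ⊔ I • ⊤) :
    Function.Surjective (LinearMap.toSpanSingleton A M θ) := by
  have htop : (⊤ : Submodule R M) ≤ (Submodule.span A {θ}).restrictScalars R :=
    Submodule.le_of_le_smul_of_le_jacobson_bot Module.Finite.fg_top hI hspan
  intro m
  have hm : m ∈ Submodule.span A {θ} := htop Submodule.mem_top
  obtain ⟨a, ha⟩ := Submodule.mem_span_singleton.mp hm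
  exact ⟨a, by simpa [LinearMap.toSpanSingleton_apply] using ha⟩

/-- **Orzech half.** If moreover `M` is abstractly `R`-isomorphic to `A` (same finite free rank: for
`A = ℤ₂[G_n]` and `M = 𝒪_{F_n}` both are `ℤ₂^{2^n}`, sub-stub W-FIN), an onto `a ↦ a·θ` is into.
[Mathlib `OrzechProperty.injective_of_surjective_of_injective`, `CommRing.orzechProperty`] -/
theorem injective_toSpanSingleton_of_equiv [Module.Finite R M] (θ : M) (e : A ≃ₗ[R] M)
    (hsurj : Function.Surjective (LinearMap.toSpanSingleton A M θ)) :
    Function.Injective (LinearMap.toSpanSingleton A M θ) := by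
  let f : A →ₗ[R] M := (LinearMap.toSpanSingleton A M θ).restrictScalars R
  have hf : Function.Surjective f := hsurj
  have hinj : Function.Injective f :=
    OrzechProperty.injective_of_surjective_of_injective e.toLinearMap f e.injective hf
  exact hinj

/-- **INTEGRAL NORMAL BASIS LEMMA.** Residual generator + finiteness + the right abstract rank ⟹ free
of rank one on `θ`.  Instance: `𝒪_{F_n} = ℤ₂[G_n]·θ_n` freely, `θ_n` any lift of a normal-basis
generator of `k_n/𝔽₂` (Mathlib `IsGalois.normalBasis`). -/
theorem isGen_of_residual [Module.Finite R M] (I : Ideal R) (hI : I ≤ (⊥ : Ideal R).jacobson)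
    (θ : M) (hspan : (⊤ : Submodule R M) ≤ (Submodule.span A {θ}).restrictScalars R ⊔ I • ⊤)
    (e : A ≃ₗ[R] M) : IsGen A θ :=
  have hs := surjective_toSpanSingleton_of_residual I hI θ hspan
  ⟨injective_toSpanSingleton_of_equiv θ e hs, hs⟩

/-- In a local ring the hypothesis `I ≤ Jac R` holds for every proper ideal, in particular for
`I = (2) ⊂ ℤ₂`. -/
theorem le_jacobson_bot_of_isLocalRing [IsLocalRing R] (I : Ideal R) (hI : I ≠ ⊤) :
    I ≤ (⊥ : Ideal R).jacobson := by
  rw [IsLocalRing.jacobson_eq_maximalIdeal ⊥ bot_ne_top]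
  exact IsLocalRing.le_maximalIdeal hI

end INB

/-! ## §2 The generator lifting step (unit lifting along a surjection from a local ring) -/

section Lift

variable {R' R : Type*} [CommRing R'] [CommRing R]
variable {M' : Type*} [AddCommGroup M'] [Module R' M'] {M : Type*} [AddCommGroup M] [Module R M]

/-- A unit multiple of a free generator is a free generator. -/
theorem isGen_units_smul {θ : M'} (hθ : IsGen R' θ) (w : R'ˣ) : IsGen R' ((w : R') • θ) := by
  constructor
  · intro r s hrs
    have h : (r * w) • θ = (s * w) • θ := by
      simpa [LinearMap.toSpanSingleton_apply, smul_smul] using hrs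
    have := hθ.1 (by simpa [LinearMap.toSpanSingleton_apply] using h)
    simpa using congrArg (· * ((w⁻¹ : R'ˣ) : R')) this
  · intro m
    obtain ⟨r, hr⟩ := hθ.2 m
    refine ⟨r * ((w⁻¹ : R'ˣ) : R'), ?_⟩
    simp only [LinearMap.toSpanSingleton_apply, smul_smul] at hr ⊢
    rw [mul_assoc, Units.inv_mul, mul_one]
    exact hr

/-- **GENERATOR LIFTING STEP.**  `ρ : R' ↠ R` onto with `R'` local, `t : M' ↠ M` onto and
`ρ`-semilinear (the trace `𝒪_{F_{n+1}} ↠ 𝒪_{F_n}` over `ℤ₂[G_{n+1}] ↠ ℤ₂[G_n]`; onto because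
`F_{n+1}/F_n` is unramified, Serre LF V §3 Lemma 4 / III Prop. 7), `M'` free of rank one on some `θ'`:
then every free generator `a` of `M` lifts to a free generator `b` of `M'` with `t b = a`.
[Mathlib `IsLocalHom.of_surjective`, `isUnit_map_iff`] -/
theorem exists_isGen_lift [IsLocalRing R'] [Nontrivial R] (ρ : R' →+* R)
    (hρ : Function.Surjective ρ) (t : M' →ₛₗ[ρ] M) (ht : Function.Surjective t)
    {θ' : M'} (hθ' : IsGen R' θ') {a : M} (ha : IsGen R a) :
    ∃ b : M', IsGen R' b ∧ t b = a := by
  classical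
  -- `t θ' = lam • a`
  obtain ⟨lam, hlam⟩ := ha.2 (t θ')
  have hlam' : t θ' = lam • a := by simpa [LinearMap.toSpanSingleton_apply] using hlam.symm
  -- `a = ρ r' • t θ'`
  obtain ⟨x', hx'⟩ := ht a
  obtain ⟨r', hr'⟩ := hθ'.2 x'
  have hr'' : r' • θ' = x' := by simpa [LinearMap.toSpanSingleton_apply] using hr'
  have hμ : a = ρ r' • t θ' := by
    rw [← hx', ← hr'', LinearMap.map_smulₛₗ]
  -- hence `ρ r' * lam = 1`, so `lam` is a unit
  have hone : ρ r' * lam = 1 := by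
    have h1 : (ρ r' * lam) • a = (1 : R) • a := by
      rw [mul_smul, ← hlam', ← hμ, one_smul]
    exact ha.1 (by simpa [LinearMap.toSpanSingleton_apply] using h1)
  have hunit : IsUnit lam := isUnit_iff_exists_inv'.mpr ⟨ρ r', hone⟩
  -- lift `lam` to a unit of `R'`
  obtain ⟨l', hl'⟩ := hρ lam
  haveI : IsLocalHom ρ := IsLocalHom.of_surjective ρ hρ
  have hl'unit : IsUnit l' := (isUnit_map_iff ρ l').mp (hl'.symm ▸ hunit)
  obtain ⟨w, hw⟩ := hl'unit
  refine ⟨((w⁻¹ : R'ˣ) : R') • θ', isGen_units_smul hθ' w⁻¹, ?_⟩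
  rw [LinearMap.map_smulₛₗ, hlam', smul_smul, ← hl', ← hw, ← map_mul, Units.inv_mul, map_one,
    one_smul]

end Lift

/-! ## §3 Trace-compatible generators along the tower = (S-Y) in Loeffler–Zerbes' form -/

section Tower

variable (R : ℕ → Type*) [∀ m, CommRing (R m)] [∀ m, IsLocalRing (R m)]
variable (ρ : ∀ m, R (m + 1) →+* R m)
variable (M : ℕ → Type*) [∀ m, AddCommGroup (M m)] [∀ m, Module (R m) (M m)]
variable (t : ∀ m, M (m + 1) →ₛₗ[ρ m] M m)

/-- **(S-Y), PROVED modulo the level inputs.**  `R m = ℤ₂[G_m]` (local; `ρ m` onto), `M m = 𝒪_{F_m}`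
(free of rank one over `R m` by §1 = W-INB), `t m = Tr_{F_{m+1}/F_m}` (onto): there is a TRACE-COMPATIBLE
system of free generators `θ = (θ_m)_m` — Loeffler–Zerbes arXiv:1108.5954 Prop. 3.3 («`lim 𝒪_{F_m}` is free
of rank one over `Λ(Γ)`»), by dependent choice on the lifting step §2 (shape = k3-g30's
`exists_coherent_of_forall_exists_lift`, re-proved here so the file is self-contained). -/
theorem exists_coherent_generators (hρ : ∀ m, Function.Surjective (ρ m))
    (ht : ∀ m, Function.Surjective (t m)) (hgen : ∀ m, ∃ θ : M m, IsGen (R m) θ) :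
    ∃ θ : ∀ m, M m, (∀ m, IsGen (R m) (θ m)) ∧ ∀ m, t m (θ (m + 1)) = θ m := by
  classical
  have hlift : ∀ m (a : M m), IsGen (R m) a →
      ∃ b : M (m + 1), IsGen (R (m + 1)) b ∧ t m b = a := fun m a ha => by
    obtain ⟨θ', hθ'⟩ := hgen (m + 1)
    exact exists_isGen_lift (ρ m) (hρ m) (t m) (ht m) hθ' ha
  let step : ∀ m, {a : M m // IsGen (R m) a} → {b : M (m + 1) // IsGen (R (m + 1)) b} :=
    fun m a => ⟨(hlift m a.1 a.2).choose, (hlift m a.1 a.2).choose_spec.1⟩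
  have hstep : ∀ m (a : {a : M m // IsGen (R m) a}), t m (step m a).1 = a.1 := fun m a =>
    (hlift m a.1 a.2).choose_spec.2
  let seq : ∀ m, {a : M m // IsGen (R m) a} := fun m =>
    Nat.rec (motive := fun m => {a : M m // IsGen (R m) a}) ⟨(hgen 0).choose, (hgen 0).choose_spec⟩
      (fun m a => step m a) m
  exact ⟨fun m => (seq m).1, fun m => (seq m).2, fun m => hstep m (seq m)⟩

variable {R M}

/-- The level isomorphism `R m ≃ M m`, `r ↦ r·θ_m` (`𝒪_{F_m} ≅ ℤ₂[G_m]` on `θ_m`). -/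
def levelEquiv {S N : Type*} [CommRing S] [AddCommGroup N] [Module S N] (θ : N) (h : IsGen S θ) :
    S ≃ₗ[S] N :=
  LinearEquiv.ofBijective (LinearMap.toSpanSingleton S N θ) h

theorem levelEquiv_apply {S N : Type*} [CommRing S] [AddCommGroup N] [Module S N] (θ : N)
    (h : IsGen S θ) (r : S) : levelEquiv θ h r = r • θ := rfl

omit [∀ m, IsLocalRing (R m)] in
/-- **Compatibility of the level isomorphisms** with trace / restriction: the square
`ℤ₂[G_{m+1}] ≅ 𝒪_{F_{m+1}} —Tr→ 𝒪_{F_m} ≅ ℤ₂[G_m]` commutes.  Passing to `lim` gives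
`lim_Tr 𝒪_{F_m} ≅ lim ℤ₂[G_m] = Λ_v` (Lang CF Ch. 5 §1 Thm 1.1; W-Λ). -/
theorem levelEquiv_compat (θ : ∀ m, M m) (hθ : ∀ m, IsGen (R m) (θ m))
    (hcoh : ∀ m, t m (θ (m + 1)) = θ m) (m : ℕ) (r : R (m + 1)) :
    t m (levelEquiv (θ (m + 1)) (hθ (m + 1)) r) = levelEquiv (θ m) (hθ m) (ρ m r) := by
  rw [levelEquiv_apply, levelEquiv_apply, LinearMap.map_smulₛₗ, hcoh]

end Tower

/-! ### §3b The consumer's shape: k3-g32's `(ev, hev, hker)` at receptacle `Y = Λ_v` -/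

section Consumer

variable {Λ : Type*} [CommRing Λ] {S N : Type*} [CommRing S] [AddCommGroup N] [Module S N]
  [Module Λ N]

/-- **GLUE TO k3-g32.**  `π : Λ_v ↠ ℤ₂[G_m]` (kernel `ω_m Λ_v`, sub-stub W-Λ), `N = 𝒪_{F_m}` a `Λ_v`-module
THROUGH `π`, `θ` a free generator (§1–§3): then `ev := (λ ↦ π(λ)·θ)` is `Λ_v`-linear, ONTO, with
`ker ev = ker π` — the hypotheses `(ev, hev, hker)` of `LevelsToLambdaK3G32.conductorFour_package` /
`conductorEight_package`, and `ev ∘ (coherent θ)` is trace-compatible by `levelEquiv_compat`. -/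
theorem consumer_ev (π : Λ →+* S) (hπ : Function.Surjective π)
    (hmod : ∀ (l : Λ) (x : N), l • x = π l • x) (θ : N) (hθ : IsGen S θ) :
    ∃ ev : Λ →ₗ[Λ] N, Function.Surjective ev ∧
      LinearMap.ker ev = (RingHom.ker π).restrictScalars Λ ∧ ∀ l, ev l = π l • θ := by
  classical
  let ev : Λ →ₗ[Λ] N :=
    { toFun := fun l => π l • θ
      map_add' := fun a b => by simp [add_smul]
      map_smul' := fun c l => by
        simp only [smul_eq_mul, map_mul, RingHom.id_apply]
        rw [mul_smul, hmod] }
  refine ⟨ev, ?_, ?_, fun l => rfl⟩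
  · intro x
    obtain ⟨r, hr⟩ := hθ.2 x
    obtain ⟨l, hl⟩ := hπ r
    exact ⟨l, by simpa [ev, hl, LinearMap.toSpanSingleton_apply] using hr⟩
  · ext l
    simp only [LinearMap.mem_ker, Submodule.restrictScalars_mem, RingHom.mem_ker]
    constructor
    · intro h
      have h' : (π l) • θ = (0 : S) • θ := by simpa [ev, zero_smul] using h
      exact hθ.1 (by simpa [LinearMap.toSpanSingleton_apply] using h')
    · intro h
      show π l • θ = 0
      rw [h, zero_smul]

end Consumer

/-! ## §4 Typed Witt-level sub-stubs (signatures; NOT proved here) -/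

/-- **W-FIN (sub-stub, size M; Serre LF II §5 Thm 4 with `e = 1`, Teichmüller lifts + `2`-adic
completeness `WittVector.isAdicCompleteIdealSpanP`):** `𝕎(k_n)` is finite free of rank `2^n` over
`𝕎(𝔽₂) = ℤ₂` — the abstract `R`-isomorphism `e : ℤ₂[G_n] ≃ 𝒪_{F_n}` that §1 consumes. -/
def WittFiniteFree (n : ℕ) : Prop :=
  Module.Finite (WittVector 2 (ZMod 2)) (OF n) ∧ Module.Free (WittVector 2 (ZMod 2)) (OF n) ∧
    Module.finrank (WittVector 2 (ZMod 2)) (OF n) = 2 ^ n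

/-- **W-INB (sub-stub, size S given §1 + W-FIN + Mathlib `IsGalois.normalBasis`):** the integral normal
basis of `𝒪_{F_n}/ℤ₂` in Witt coordinates — some `θ ∈ 𝕎(k_n)` whose Galois conjugates are a
`𝕎(𝔽₂)`-basis. -/
def WittIntegralNormalBasis (n : ℕ) : Prop :=
  ∃ θ : OF n, Function.Bijective
    (fun c : (kF n ≃ₐ[ZMod 2] kF n) → WittVector 2 (ZMod 2) => ∑ g, c g • galAct n g θ)

open Polynomial in
/-- `ω_n = (1+T)^{2^n} − 1 ∈ Λ₂ = ℤ₂⟦T⟧` (the tree's `IwasawaAlgebra 2`; k3-g32's `omega`). -/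
def omega (n : ℕ) : Literature.NumberTheory.EllipticCurves.IwasawaAlgebra 2 :=
  (1 + PowerSeries.X) ^ (2 ^ n) - 1

/-- **W-Λ (sub-stub, size S; Lang, *Cyclotomic Fields* Ch. 5 §1 Thm 1.1; tree
`IwasawaAlgebra.quotientPowEquiv` = Weierstrass division by the distinguished `ω_n`):**
`Λ₂/ω_n ≅ ℤ₂[C_{2^n}]`, `T ↦ γ − 1`. -/
def IwasawaModOmega (n : ℕ) : Prop :=
  Nonempty ((Literature.NumberTheory.EllipticCurves.IwasawaAlgebra 2 ⧸
      Ideal.span {omega n}) ≃ₐ[ℤ_[2]] MonoidAlgebra ℤ_[2] (Multiplicative (ZMod (2 ^ n))))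

/-! ## §5 The extreme layer: the ONE finite frame that decides conductor 4 -/

/-- **The deciding field for BOTH conductor-`4` keys `u ∈ {−1, 3}` at layer `1`:**
`L_1 = F_1(√u) = ℚ₂(ζ₃, i) = ℚ₂(ζ₁₂)` (the same field and the same `σ : i ↦ −i` for `u = −1` and
`u = 3`, since `√3 = ± i·√−3` and `√−3 ∈ F_1 = ℚ₂(ζ₃)`). -/
abbrev LFour : Type := CyclotomicField 12 ℚ_[2]

/-- Certificate: `L_1` carries the complete ultrametric normed-field structure k3-g31's frame vocabulary
`[NontriviallyNormedField L] [NormedAlgebra ℚ_[2] L]` wants (Mathlib spectral norm; unique extension of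
`|·|₂`). -/
example : NontriviallyNormedField LFour :=
  haveI : Module.Finite ℚ_[2] LFour := IsCyclotomicExtension.finite {12} ℚ_[2] LFour
  spectralNorm.nontriviallyNormedField ℚ_[2] LFour

/-- Certificate: `[L_1 : ℚ₂] < ∞` (so `L_1` is complete and proper for the spectral norm:
Mathlib `spectralNorm.completeSpace`, `ProperSpace ℚ_[p]`). -/
example : Module.Finite ℚ_[2] LFour := IsCyclotomicExtension.finite {12} ℚ_[2] LFour

/-- **Friction F-DEG, typed (sub-stub, size XS):** `Φ₁₂` is irreducible over `ℚ₂`, i.e.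
`[L_1 : ℚ₂] = 4` (`F_1 = ℚ₂(ζ₃)` unramified and `ℚ₂(i)` ramified are linearly disjoint).  With it
Mathlib's `IsCyclotomicExtension.autEquivPow` gives `Gal(L_1/ℚ₂) ≃* (ℤ/12)ˣ = {1, 5, 7, 11}`:
`φ = (ζ ↦ ζ⁵)` (Frobenius of `F_1`, fixes `i = ζ³`), `σ = (ζ ↦ ζ⁷)` (fixes `ζ₃ = ζ⁴`, `i ↦ −i`),
commuting — the dictionary hypothesis R205 (vi) at layer 1. -/
def CyclotomicTwelveIrreducible : Prop := Irreducible (Polynomial.cyclotomic 12 ℚ_[2])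

/-- PROVED: `i ∈ L_1` — `I = ζ₁₂³` satisfies `I² = −1`. -/
theorem LFour.exists_sq_eq_neg_one : ∃ I : LFour, I ^ 2 = -1 := by
  have hζ := IsCyclotomicExtension.zeta_spec 12 ℚ_[2] LFour
  refine ⟨(IsCyclotomicExtension.zeta 12 ℚ_[2] LFour) ^ 3, ?_⟩
  rw [← pow_mul]
  exact (hζ.pow (by norm_num) (by norm_num)).eq_neg_one_of_two_right

/-- PROVED: `ζ₃ ∈ L_1` — `z = ζ₁₂⁴` is a primitive cube root of unity (so `F_1 = ℚ₂(ζ₃) ⊆ L_1`). -/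
theorem LFour.exists_primitiveRoot_three : ∃ z : LFour, IsPrimitiveRoot z 3 :=
  ⟨(IsCyclotomicExtension.zeta 12 ℚ_[2] LFour) ^ 4,
    (IsCyclotomicExtension.zeta_spec 12 ℚ_[2] LFour).pow (by norm_num) (by norm_num)⟩

/-- **PROVED METRIC CERTIFICATE at the extreme layer (the `ram`/`unif` fields of `CondFourFrame`, norm
form): for ANY `I ∈ L_1` with `I² = −1`, `‖1 + I‖² = ‖2‖ = 1/2` for the spectral norm extending `|·|₂` —
so `ϖ = 1 + I` has `|ϖ| = 2^{−1/2} ∉ |ℚ₂ˣ|` and `e(L_1/ℚ₂) ≥ 2` (with F-DEG and `f ≥ 2` from `ζ₃`: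
`e = f = 2`).  No valuation API is assumed: only multiplicativity of Mathlib's `spectralMulAlgNorm`. -/
theorem LFour.spectralNorm_one_add_sq (I : LFour) (hI : I ^ 2 = -1) :
    spectralNorm ℚ_[2] LFour (1 + I) ^ 2 = 2⁻¹ := by
  haveI : Module.Finite ℚ_[2] LFour := IsCyclotomicExtension.finite {12} ℚ_[2] LFour
  have hf : ∀ x, spectralMulAlgNorm ℚ_[2] LFour x = spectralNorm ℚ_[2] LFour x :=
    spectralMulAlgNorm_def
  have hmul : ∀ x y : LFour, spectralNorm ℚ_[2] LFour (x * y) =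
      spectralNorm ℚ_[2] LFour x * spectralNorm ℚ_[2] LFour y := fun x y => by
    rw [← hf, ← hf, ← hf, map_mul]
  have hpow : ∀ (x : LFour) (n : ℕ), spectralNorm ℚ_[2] LFour (x ^ n) =
      spectralNorm ℚ_[2] LFour x ^ n := fun x n => by
    rw [← hf, ← hf, map_pow]
  have hsq : (1 + I) ^ 2 = algebraMap ℚ_[2] LFour 2 * I := by
    rw [map_ofNat]
    linear_combination hI
  have hI4 : I ^ 4 = 1 := by
    rw [show (4 : ℕ) = 2 * 2 from rfl, pow_mul, hI]
    norm_num
  have hnI : spectralNorm ℚ_[2] LFour I = 1 := by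
    have h := hpow I 4
    rw [hI4, spectralNorm_one] at h
    exact (pow_eq_one_iff_of_nonneg (spectralNorm_nonneg I) (by norm_num)).mp h.symm
  have h2 : ‖(2 : ℚ_[2])‖ = 2⁻¹ := by
    have := Padic.norm_p (p := 2)
    exact_mod_cast this
  rw [← hpow, hsq, hmul, hnI, mul_one, spectralNorm_extends, h2]

/-- **F-4a (sub-stub, size S; friction F-DEG = `[ℚ₂(ζ₁₂) : ℚ₂] = 4`, i.e. `Φ₁₂` irreducible over `ℚ₂`):**
the ALGEBRAIC half of `CondFourFrame` at layer `1` — an involution `σ` of `L_1/ℚ₂` fixing `F_1 = ℚ₂(ζ₃)`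
with `σ I = −I`, `I² = −1`, together with the Frobenius lift `φ` (`φ I = I`, `φ z = z²` on cube roots of
unity, `σφ = φσ`) — R205 (i) + (vi) at layer 1; `ϖ = 1 + I`, whose metric half is PROVED above. -/
def FrameFourLayerOneAlgebraic : Prop :=
  ∃ (σ φ : LFour ≃ₐ[ℚ_[2]] LFour) (I : LFour), I ^ 2 = -1 ∧ σ I = -I ∧ φ I = I ∧
    σ.trans σ = AlgEquiv.refl ∧ σ.trans φ = φ.trans σ ∧
    ∀ z : LFour, z ^ 3 = 1 → σ z = z ∧ φ z = z ^ 2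

/-- `ζ₁₂ ∈ L_1` (Mathlib's chosen primitive 12th root of unity). -/
def LFour.zeta : LFour := IsCyclotomicExtension.zeta 12 ℚ_[2] LFour

theorem LFour.zeta_spec : IsPrimitiveRoot LFour.zeta 12 :=
  IsCyclotomicExtension.zeta_spec 12 ℚ_[2] LFour

/-- **PROVED modulo the friction F-DEG:** the algebraic frame at the deciding layer —
`σ = (ζ₁₂ ↦ ζ₁₂⁷)`, `φ = (ζ₁₂ ↦ ζ₁₂⁵)`, `I = ζ₁₂³`: `I² = −1`, `σI = −I`, `φI = I`, `σ² = 1`, `σφ = φσ`,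
`σ` fixes and `φ` squares the cube roots of unity (`F_1 = ℚ₂(ζ₃) = L_1^σ`, `φ|_{F_1}` = Frobenius).
R205 (i) (algebraic half) + (vi) at layer 1, ONE field for both conductor-4 keys. -/
theorem frameFourLayerOneAlgebraic_of_irreducible (h : CyclotomicTwelveIrreducible) :
    FrameFourLayerOneAlgebraic := by
  classical
  have hζ := LFour.zeta_spec
  have h12 : LFour.zeta ^ 12 = 1 := hζ.pow_eq_one
  have h6 : LFour.zeta ^ 6 = -1 :=
    (hζ.pow (by norm_num) (show 12 = 6 * 2 by norm_num)).eq_neg_one_of_two_right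
  have h7 : IsPrimitiveRoot (LFour.zeta ^ 7) 12 := hζ.pow_of_coprime 7 (by decide)
  have h5 : IsPrimitiveRoot (LFour.zeta ^ 5) 12 := hζ.pow_of_coprime 5 (by decide)
  have hpow : ∀ a k : ℕ, LFour.zeta ^ (a + 12 * k) = LFour.zeta ^ a := fun a k => by
    rw [pow_add, pow_mul, h12, one_pow, mul_one]
  let σ : LFour ≃ₐ[ℚ_[2]] LFour := IsCyclotomicExtension.fromZetaAut h7 h
  let φ : LFour ≃ₐ[ℚ_[2]] LFour := IsCyclotomicExtension.fromZetaAut h5 h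
  have hσ : σ LFour.zeta = LFour.zeta ^ 7 := IsCyclotomicExtension.fromZetaAut_spec h7 h
  have hφ : φ LFour.zeta = LFour.zeta ^ 5 := IsCyclotomicExtension.fromZetaAut_spec h5 h
  refine ⟨σ, φ, LFour.zeta ^ 3, ?_, ?_, ?_, ?_, ?_, ?_⟩
  · rw [← pow_mul, show 3 * 2 = 6 from rfl]
    exact h6
  · rw [map_pow, hσ, ← pow_mul, show 7 * 3 = (3 + 6) + 12 * 1 from rfl, hpow, pow_add, h6,
      mul_neg_one]
  · rw [map_pow, hφ, ← pow_mul, show 5 * 3 = 3 + 12 * 1 from rfl, hpow]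
  · apply AlgEquiv.coe_toAlgHom_injective
    refine (hζ.powerBasis ℚ_[2]).algHom_ext ?_
    rw [hζ.powerBasis_gen ℚ_[2]]
    show σ (σ LFour.zeta) = LFour.zeta
    rw [hσ, map_pow, hσ, ← pow_mul, show 7 * 7 = 1 + 12 * 4 from rfl, hpow, pow_one]
  · apply AlgEquiv.coe_toAlgHom_injective
    refine (hζ.powerBasis ℚ_[2]).algHom_ext ?_
    rw [hζ.powerBasis_gen ℚ_[2]]
    show φ (σ LFour.zeta) = σ (φ LFour.zeta)
    rw [hσ, hφ, map_pow, map_pow, hσ, hφ, ← pow_mul, ← pow_mul, Nat.mul_comm]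
  · intro z hz
    have h4 : IsPrimitiveRoot (LFour.zeta ^ 4) 3 :=
      hζ.pow (by norm_num) (show 12 = 4 * 3 by norm_num)
    obtain ⟨i, -, rfl⟩ := h4.eq_pow_of_pow_eq_one hz
    have hz' : (LFour.zeta ^ 4) ^ i = LFour.zeta ^ (4 * i) := (pow_mul _ _ _).symm
    rw [hz']
    refine ⟨?_, ?_⟩
    · rw [map_pow, hσ, ← pow_mul, show 7 * (4 * i) = 4 * i + 12 * (2 * i) by ring, hpow]
    · rw [map_pow, hφ, ← pow_mul, ← pow_mul, show 5 * (4 * i) = 4 * i * 2 + 12 * i by ring, hpow]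

end Summit.BirchSwinnertonDyer.BirchSwinnertonDyer.Cruxes.SplitBadTwoLowerHalfOfFacts.WittTowerK3G33

end
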